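import Summits.Ventures.Crystal3D.Kissing125.SearchCheck3
import HarnessLib

/-!
# The growth-search checker (computable part), κ-generic — part 1/2

HONEST FRAMING (cell pub-crystal3d, K-path at `h = 5/4`, V4 = κ as an explicit parameter): this is NOT a result printed
by Hales; it is his METHOD (arXiv:1209.6043, Theorem 3 + Lemmas 7–10, in the tree's form of a verified interval-arithmetic
growth search, `Literature/…/KissingSearch*.lean`) with the largest long-side cosine `κ` made an EXPLICIT PARAMETER
(`κ : Kappa`, carrying the two numeric facts the soundness proof uses: `-1/2 ≤ κ`, `κ < 1/4`).  Only the declarations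
whose statement depends on `κ` are declared here (namespace `…Kissing125.GSearch`, the tree's short names, no renames);
every κ-free helper is the landed K25 copy (`…Kissing125.KissingSearch.*`) and every κ-free lemma is cited from the tree
(PRIVATE per-file citation aliases; `GSearchTransport.lean` holds `toT : St → tree St` and the transport equalities).  The K25
instance is `κ25 = ⟨7/32, …⟩`; `GSearchBridge.lean` identifies the generic checker at
`κ25` with the landed `Kissing125.KissingSearch.checkPart`, so the landed run files are consumed unchanged.  Generated by
`HOME/lean/kissing125/v4-prep/gen/mkgen.py`; nothing here is asserted about GAP(1.26) or any census.

THIS FILE: the κ-tainted declarations of `Literature/Geometry/DiscreteGeometry/KissingSearchCheck.lean` (part 1 of 2), with `κ : Kappa` threaded; κ-free declarations of that file are NOT re-declared publicly (the κ-free helpers are the landed K25 copies; the κ-free tree lemmas used by the proofs are cited through PRIVATE aliases at the top of the file).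

## References
* T. C. Hales, *A proof of Fejes Tóth's conjecture on sphere packings with kissing number twelve*,
  arXiv:1209.6043 (2012): Definition 1, Theorem 2, Theorem 3, Lemmas 7–10. [`Hales2012`]
* R. E. Moore, *Interval Analysis* (1966), Theorem 3.1, §4.4. [`Moore1966`]
-/

namespace Summit.Ventures.Crystal3D.Kissing125

open Literature.Geometry.DiscreteGeometry
open Summit.Ventures.Crystal3D.Kissing125.KissingSearch

namespace GSearch

open Real Literature.Analysis.ValidatedNumerics KissingLP NonemptyInterval Finset

/-- The search parameter: the largest cosine `κ` of a long side, with the two numeric facts the soundness proof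
uses (`-1/2 ≤ κ`: the cosine grid is increasing; `κ < 1/4`: the cells below `ZCELL = 11` are negative). [folklore] -/
structure Kappa where
  /-- the value -/
  val : ℚ
  /-- the grid `-1/2 … κ` is nondegenerate -/
  neg_half_le : -(1 / 2 : ℚ) ≤ val
  /-- `gridPt 10 < 0` -/
  lt_quarter : val < 1 / 4

/-- `κ` as a real number. [cite: Hales2012, Definition 1] -/
noncomputable def κR (κ : Kappa) : ℝ := ((κ.val : ℚ) : ℝ)

/-! ### Part A. Numeric kernel -/

/-- Grid point `j` (`j = 0 … K`): `-1/2 + j (κ₀ + 1/2)/K`. [folklore] -/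
def gridPt (κ : Kappa) (j : ℕ) : ℚ := -1 / 2 + (κ.val + 1 / 2) * j / K

/-- The cosine interval of a side symbol: `0` = contact (`1/2`), `j = 1 … K` = cell
`[gridPt (j-1), gridPt j]`. [folklore] -/
def symIv (κ : Kappa) (s : ℕ) : NonemptyInterval ℚ :=
  if s = 0 then mkIv (1 / 2) (1 / 2) else mkIv (gridPt κ (s - 1)) (gridPt κ s)

/-- The box of a symbol triple. [folklore] -/
def symBox (κ : Kappa) (a b c : ℕ) : ℕ → NonemptyInterval ℚ :=
  fun i => if i = 0 then symIv κ a else if i = 1 then symIv κ b else symIv κ c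

/-- **The basic bracket of a slot** over a triple of symbols (`a`, `b` the sides at the vertex,
`c` the opposite side): `NOBR` if the circumradius polynomial is certified `≤ 0` on the box,
otherwise the ladder bracket of `arccos` of the enclosed quotient. [folklore] -/
def basic (κ : Kappa) (a b c : ℕ) : ℕ :=
  match pExpr.enclose PREC ITERS (symBox κ a b c) with
  | none => mkBr 0 NLAD
  | some P =>
    if P.snd ≤ 0 then NOBR
    else
      match qExpr.enclose PREC ITERS (symBox κ a b c) with
      | none => mkBr 0 NLAD
      | some Q => mkBr (ladDown (dyCeil PREC Q.snd)) (ladUp (dyFloor PREC Q.fst))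

/-- The table of basic brackets, flat index `(a * NS + b) * NS + c`. [folklore] -/
def BTAB (κ : Kappa) : Array ℕ := Array.ofFn (n := NS * NS * NS) fun i =>
  basic κ (i.1 / (NS * NS)) ((i.1 / NS) % NS) (i.1 % NS)

/-- Lookup in `BTAB`. [folklore] -/
def btab (κ : Kappa) (a b c : ℕ) : ℕ := (BTAB κ).getD ((a * NS + b) * NS + c) NOBR

/-- Bracket over an opposite-side domain for fixed vertex-side symbols. [folklore] -/
def rangeC (κ : Kappa) (a b r : ℕ) : ℕ := foldSyms (fun acc c => brHull acc (btab κ a b c)) r NOBR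

/-- Table of `rangeC`, flat index `(a * NS + b) * 256 + (16 lo + hi)`, the contact domain at
`(0, 0)`. [folklore] -/
def T1TAB (κ : Kappa) : Array ℕ := Array.ofFn (n := NS * NS * 256) fun i =>
  let ab := i.1 / 256
  let lh := i.1 % 256
  if lh = 0 then rangeC κ (ab / NS) (ab % NS) 0 else rangeC κ (ab / NS) (ab % NS) (mkR (lh / 16) (lh % 16))

/-- Lookup in `T1TAB` by the domain code of the opposite side. [folklore] -/
def t1 (κ : Kappa) (a b r : ℕ) : ℕ :=
  (T1TAB κ).getD ((a * NS + b) * 256 + (if r = 0 then 0 else 16 * rLo r + rHi r)) NOBR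

/-- **Bracket of a slot over three side domains** (`ra`, `rb` at the vertex, `rc` opposite).
[folklore] -/
def rangeBr (κ : Kappa) (ra rb rc : ℕ) : ℕ :=
  if ra = 0 then (if rb = 0 then t1 κ 0 0 rc else foldSyms (fun acc b => brHull acc (t1 κ 0 b rc)) rb NOBR)
  else if rb = 0 then foldSyms (fun acc a => brHull acc (t1 κ a 0 rc)) ra NOBR
  else foldSyms (fun acc a => foldSyms (fun acc' b => brHull acc' (t1 κ a b rc)) rb acc) ra NOBR

/-- The smallest lower end of any feasible basic bracket: a lower bound for every angle of
every fan triangle. [folklore] -/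
def THMIN (κ : Kappa) : ℕ := (BTAB κ).foldl (fun m br => if br = NOBR then m else min m (brLo br)) NLAD

/-! ### Part B. States, propagation, search -/

/-- Bracket of the slot of triangle `t` at its vertex `v`. [folklore] -/
def St.slotBr (κ : Kappa) (s : St) (t v : ℕ) : ℕ :=
  let p := others t v
  rangeBr κ (s.gdom v p.1) (s.gdom v p.2) (s.gdom p.1 p.2)

/-- Trim the domain of one side of the slot `(t, v)` (role `0`: side `{v,a}`, `1`: `{v,b}`,
`2`: `{a,b}`) to the cells whose bracket is feasible and meets the window `[wlo, whi]`,
removing cells from the two ends only; `none` if nothing is left. [cite: Moore1966, §4.4] -/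
def St.trimSide (κ : Kappa) (s : St) (t v role wlo whi : ℕ) : Option St :=
  let p := others t v
  let a := p.1
  let b := p.2
  let ra := s.gdom v a
  let rb := s.gdom v b
  let rc := s.gdom a b
  let r := if role = 0 then ra else if role = 1 then rb else rc
  if r = 0 ∨ r = UNL then some s
  else
    let ok : ℕ → Bool := fun c =>
      let rr := mkR c c
      let br := if role = 0 then rangeBr κ rr rb rc else if role = 1 then rangeBr κ ra rr rc else rangeBr κ ra rb rr
      br != NOBR && brLo br ≤ whi && wlo ≤ brHi br
    let lo := rLo r
    let hi := rHi r
    match firstOk ok lo (hi + 1 - lo) with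
    | none => none
    | some lo' =>
      match lastOk ok hi (hi + 1 - lo') with
      | none => none
      | some hi' =>
        let r' := mkR lo' hi'
        if r' = r then some s
        else some (if role = 0 then s.sdom v a r' else if role = 1 then s.sdom v b r' else s.sdom a b r')

/-- Sum of the lower / upper ends of the slot brackets at `v` over the given triangles at `v`
(`none` if a slot is infeasible). [folklore] -/
def St.slotSums (κ : Kappa) (s : St) (v : ℕ) (tv : List ℕ) : Option (ℕ × ℕ) :=
  tv.foldl (fun acc t =>
    match acc with
    | none => none
    | some (sl, sh) =>
      (let br := St.slotBr κ s t v; if br = NOBR then none else some (sl + brLo br, sh + brHi br))) (some (0, 0))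

/-- Window trimming of the slots at a closed label `v` (triangles `tv` at `v`), given the sums
`sl, sh` of the lower / upper ends of the slot brackets at `v` in `s` (brackets of `s` are
valid for every narrowing of `s`, so the windows computed from them stay sound while the state
is trimmed). [folklore] -/
def St.trimAt (κ : Kappa) (s : St) (v sl sh : ℕ) (tv : List ℕ) : Option St :=
  tv.foldl (fun os t =>
    match os with
    | none => none
    | some s1 =>
      let br := St.slotBr κ s t v
      if br = NOBR then none
      else
        let wlo := TWOPI_LO - (sh - brHi br)
        let whi := TWOPI_HI - (sl - brLo br)
        match St.trimSide κ s1 t v 0 wlo whi with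
        | none => none
        | some s2 => match St.trimSide κ s2 t v 1 wlo whi with
          | none => none
          | some s3 => St.trimSide κ s3 t v 2 wlo whi) (some s)

/-- **The node rule at `v`**: nothing if `v` has no triangle; kill on an inconsistent link or an
infeasible slot; at a CLOSED label (every side at `v` in `0` or `2` placed triangles: under the
single-cycle link axiom all triangles at `v` are then placed) require `Σ lo < 12868`,
`12867 ≤ Σ hi` and trim the windows; at an open one require `Σ lo + THMIN < 12868`.
[cite: Hales2012, proof of Lemma 9 (node equations)] -/
def St.nodeRule (κ : Kappa) (s : St) (v : ℕ) : Option St :=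
  let (nv, ne, bad, verts) := s.linkSummary v
  if nv = 0 then some s
  else if s.badLink v verts bad then none
  else
    let tv := s.trisAt v
    match St.slotSums κ s v tv with
    | none => none
    | some (sl, sh) =>
      if ne = 0 then
        (if TWOPI_HI ≤ sl ∨ sh < TWOPI_LO then none else St.trimAt κ s v sl sh tv)
      else if TWOPI_HI ≤ sl + THMIN κ then none
      else some s

/-- Feasibility trimming of the three sides of every placed triangle at `v`. [folklore] -/
def St.trimTrisAt (κ : Kappa) (s : St) (v : ℕ) : Option St :=
  (s.trisAt v).foldl (fun os t =>
    match os with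
    | none => none
    | some s =>
      match St.trimSide κ s t (tv0 t) 0 0 NLAD with
      | none => none
      | some s => match St.trimSide κ s t (tv0 t) 1 0 NLAD with
        | none => none
        | some s => St.trimSide κ s t (tv0 t) 2 0 NLAD) (some s)

/-- The local propagation step at `v`: triangle trims at `v`, pairing at `v`, node rule at `v`.
[folklore] -/
def St.localStep (κ : Kappa) (s : St) (v : ℕ) : Option St :=
  match St.trimTrisAt κ s v with
  | none => none
  | some s => match s.pairRulesAt v with
    | none => none
    | some s => St.nodeRule κ s v

/-- **Propagation** (worklist form): apply the local step at dirty labels until none is left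
(at most `fuel` steps); a domain change makes the dependent labels dirty. [cite: Moore1966, §4.4] -/
def St.propagateWL (κ : Kappa) (s : St) : ℕ → List ℕ → Option St
  | 0, _ => some s
  | _ + 1, [] => some s
  | fuel + 1, v :: rest =>
    if 12 ≤ v then St.propagateWL κ s fuel rest
    else
      match St.localStep κ s v with
      | none => none
      | some s' =>
        let newDirty := (s.dirtyFrom s' v).filter fun u => !(rest.contains u)
        St.propagateWL κ s' fuel (rest ++ newDirty)

/-- Propagation from scratch (every used label dirty). [folklore] -/
def St.propagate (κ : Kappa) (s : St) (fuel : ℕ) : Option St :=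
  St.propagateWL κ s fuel ((List.range 12).filter fun v => s.hdeg2 v != 0)

/-- Refutation of a complete leaf by bisection of long-side ranges: `true` iff every sub-box is
killed by propagation. [cite: Moore1966, §4.4] -/
def St.refute (κ : Kappa) (s : St) : ℕ → Bool
  | 0 => false
  | fuel + 1 =>
    match St.propagate κ s 300 with
    | none => true
    | some s =>
      match s.widest with
      | none => false
      | some (a, b) =>
        let r := s.gdom a b
        let mid := (rLo r + rHi r) / 2
        St.refute κ (s.sdom a b (mkR (rLo r) mid)) fuel && St.refute κ (s.sdom a b (mkR (mid + 1) (rHi r))) fuel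

/-- **One level of the search.**  Propagate (dirty labels `dirty`); kill at a closed root
without its four contacts; if no open side is left, the placed triangles must be all twenty on
all twelve labels and the leaf is accepted (FCC/HCP) or refuted by bisection; otherwise grow
at the chosen open side `{v, a}` over every third vertex `c` (an old label with room on
`{v,c}`, `{a,c}`, or the smallest new label) and every labelling of the new sides. [folklore] -/
def St.expand (κ : Kappa) (s : St) (dirty : List ℕ) : Node :=
  match St.propagateWL κ s 400 dirty with
  | none => .leaf true
  | some s =>
    if s.rootKill then .leaf true
    else
      match s.chooseOpen with
      | none =>
        .leaf (if s.tris.size != 20 || s.nused != 12 then true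
          else if s.accept then true
          else St.refute κ s 40)
      | some (v, a, b) =>
        if 20 ≤ s.tris.size then .leaf true
        else
          .branch
            (((List.range 12).filter fun c =>
                !(c == v || c == a || c == b || s.hdeg2 c == 0 || 2 ≤ s.gsc v c || 2 ≤ s.gsc a c)).flatMap
                (fun c => s.kidsAt v a c) ++
              (match s.newLabel with
                | none => []
                | some n => s.kidsAt v a n))

/-- **The search**: `true` means every structure consistent with the state has an FCC or HCP
contact graph (`KissingSearchSearch.lean`). [folklore] -/
def St.search (κ : Kappa) (s : St) (dirty : List ℕ) : ℕ → Bool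
  | 0 => false
  | fuel + 1 =>
    match St.expand κ s dirty with
    | .leaf b => b
    | .branch kids => kids.all fun p => St.search κ p.1 p.2 fuel


end GSearch

end Summit.Ventures.Crystal3D.Kissing125
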